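import Summits.QuantumAdvantage.QuantumAdvantage.Theorems.WbwObfuscatedGluedTreesKowGenVocabulary
import Literature.Computability.Cryptography.ObfuscatedGluedTrees
import Literature.Computability.Complexity.CodeFPStringKit
import Literature.Computability.Complexity.CodeFPStrings
import Literature.Computability.Complexity.CodeFPArith

/-!
# Toolkit stub `toolkit_nbrBitFP` — assembly of `NbrBitFP P` from the glued-trees oracle on codes
# (crux `WbwObfuscatedGluedTrees`, stmt-QuantumAdvantage-2340; line `knowledge-of-walk-split`, stage 3, piece G6 of `NbrBitFP`)

From the ORACLE statement on codes (hypothesis; piece G5): on the code of `t = (1^μ, 1^d, k₁, k₂, k₃, k₄, y)` an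
`FP` string function returns the raw list `R = (gluedTreesOracle σ ν (vecOf N y)).map List.ofFn` of the sorted
neighbour names of the vertex named by the first `N = nameLen μ d` bits of `y` (`σ = cycleOf P μ k₃ k₄ d`,
`ν = naming P μ k₁ k₂ d`, `1 ≤ d`), we derive the neighbour PREDICATE `nbrBit σ ν X` of the query
`X i = y.getD i false` (`i < 2N`) on codes:

* the answer string is `answerBits σ ν a = fit (3N + 2) (bitsOf 2 |R| ++ R.flatten)` with `a = vecOf N y` the first
  half of the query (`CodeFP.natLength`, two parity bits by `natMod`/`natDiv`/`natEq`, `CodeFP.strFlatten`,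
  `FPData.fitFP`);
* the output position is `nameVal b` for the second half `b i = y.getD (N + i) false`, and
  `nameVal b = bitsToNat (fit N (y.drop N))` (`bitsToNat (List.ofFn f) = nameVal f`; `CodeFP.strDrop`, `fitFP`,
  `CodeFP.strVal`);
* the bit is read by `CodeFP.strGetDNat`, and the guard `1 ≤ d` is a `CodeFP.ite` on `CodeFP.unLeNat`.
[folklore]
-/

set_option linter.dupNamespace false

noncomputable section

namespace Summit.QuantumAdvantage.QuantumAdvantage.Theorems.WbwObfuscatedGluedTrees.KnowledgeOfWalk.Generator

open Literature.Computability.Cryptography Literature.Computability.Complexity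
open Literature.Computability.Cryptography.ObfuscatedGluedTrees Literature.Computability.QuantumComplexity
open Literature.Computability.Complexity.CodeFP (natE unE bitE pairE strE rawE)

/-! ## Binary values of listed bit vectors -/

/-- The little-endian value of a listed bit vector is the binary value `nameVal` of the vector. [folklore] -/
private theorem bitsToNat_ofFn_eq_nameVal :
    ∀ {N : ℕ} (f : Fin N → Bool), bitsToNat (List.ofFn f) = GluedTrees.nameVal f
  | 0, f => by simp [GluedTrees.nameVal]
  | N + 1, f => by
    rw [List.ofFn_succ, bitsToNat_cons, bitsToNat_ofFn_eq_nameVal]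
    simp only [GluedTrees.nameVal, Fin.sum_univ_succ, Fin.val_zero, pow_zero, mul_one, Fin.val_succ, pow_succ,
      Finset.mul_sum]
    congr 1
    exact Finset.sum_congr rfl fun i _ => by ring

/-- `fit N s` lists the padded reading `i ↦ s.getD i false` of `s` on `Fin N`. [folklore] -/
private theorem fit_eq_ofFn_getD (N : ℕ) (s : List Bool) :
    fit N s = List.ofFn fun i : Fin N => s.getD (i : ℕ) false := by
  apply List.ext_getElem
  · simp
  · intro i h₁ h₂
    rw [List.getElem_ofFn]
    simp only [fit, List.getElem_take]
    rw [List.getElem_append]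
    split_ifs with hi
    · rw [List.getD_eq_getElem _ _ hi]
    · rw [List.getElem_replicate, List.getD_eq_default _ _ (not_lt.1 hi)]

/-- **The output position read off the query string**: the binary value of `fit N (y ⇂ N)` is `nameVal` of
the second half `i ↦ y.getD (N + i) false` of the query. [folklore] -/
private theorem bitsToNat_fit_drop (N : ℕ) (y : List Bool) :
    bitsToNat (fit N (y.drop N)) = GluedTrees.nameVal (fun i : Fin N => y.getD (N + (i : ℕ)) false) := by
  rw [fit_eq_ofFn_getD, bitsToNat_ofFn_eq_nameVal]
  congr 1
  funext i
  rw [List.getD_eq_getElem?_getD, List.getD_eq_getElem?_getD, List.getElem?_drop]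

/-- The two low-order bits of `n` are its parity and the parity of `n / 2`. [folklore] -/
private theorem bitsOf_two (n : ℕ) : bitsOf 2 n = [decide (n % 2 = 1), decide (n / 2 % 2 = 1)] := by
  simp [bitsOf, List.ofFn_succ, Nat.testBit_succ]

/-! ## The assembly on plain data -/

/-- **Assembly on plain data**: from ANY map `R` computed on the codes of `t = (1^μ, 1^d, k₁, k₂, k₃, k₄, y)` into
raw lists of strings, the bit at position `bitsToNat (fit N (y ⇂ N))` of the answer string
`fit (3N + 2) (bitsOf 2 |R t| ++ (R t).flatten)` (`N = nameLen μ d`), guarded by `1 ≤ d`, is computed on codes.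
[folklore] -/
private theorem nbrBit_assemble
    (R : ℕ × ℕ × List Bool × List Bool × List Bool × List Bool × List Bool → List (List Bool))
    (hR : CodeFP (pairE unE (pairE unE (pairE strE (pairE strE (pairE strE (pairE strE strE)))))) (rawE strE) R) :
    CodeFP (pairE unE (pairE unE (pairE strE (pairE strE (pairE strE (pairE strE strE)))))) bitE
      (fun t : ℕ × ℕ × List Bool × List Bool × List Bool × List Bool × List Bool =>
        if 1 ≤ t.2.1 then
          (fit (ansLen (nameLen t.1 t.2.1)) (bitsOf 2 (R t).length ++ (R t).flatten)).getD
            (bitsToNat (fit (nameLen t.1 t.2.1) (t.2.2.2.2.2.2.drop (nameLen t.1 t.2.1)))) false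
        else false) := by
  let inE : ℕ × ℕ × List Bool × List Bool × List Bool × List Bool × List Bool → List Bool :=
    pairE unE (pairE unE (pairE strE (pairE strE (pairE strE (pairE strE strE)))))
  have hμ : CodeFP inE unE (fun t => t.1) := CodeFP.fst _ _
  have hd : CodeFP inE unE (fun t => t.2.1) := (CodeFP.snd _ _).fst'
  have hy : CodeFP inE strE (fun t => t.2.2.2.2.2.2) := (CodeFP.snd _ _).snd'.snd'.snd'.snd'.snd'
  -- the name length `N = μ + (2d + 3)` and the answer length `3N + 2`, in unary
  have hN : CodeFP inE unE (fun t => nameLen t.1 t.2.1) :=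
    (CodeFP.unAdd.comp (hμ.pair (CodeFP.unAdd.comp
      (((CodeFP.unMulConst 2).comp hd).pair (CodeFP.const inE (3 : ℕ)))))).congr fun _ => rfl
  have hAnsLen : CodeFP inE unE (fun t => ansLen (nameLen t.1 t.2.1)) :=
    (CodeFP.unAdd.comp (((CodeFP.unMulConst 3).comp hN).pair (CodeFP.const inE (2 : ℕ)))).congr fun _ => rfl
  -- the answer string `fit (3N + 2) (bitsOf 2 |R| ++ R.flatten)`
  have hR' : CodeFP inE (rawE strE) R := hR
  have hlen : CodeFP inE natE (fun t => (R t).length) := (CodeFP.natLength strE).comp hR'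
  have hb0 : CodeFP inE bitE (fun t => decide ((R t).length % 2 = 1)) :=
    CodeFP.natEq.comp ((CodeFP.natMod.comp (hlen.pair (CodeFP.const inE (2 : ℕ)))).pair (CodeFP.const inE (1 : ℕ)))
  have hb1 : CodeFP inE bitE (fun t => decide ((R t).length / 2 % 2 = 1)) :=
    CodeFP.natEq.comp ((CodeFP.natMod.comp ((CodeFP.natDiv.comp (hlen.pair (CodeFP.const inE (2 : ℕ)))).pair
      (CodeFP.const inE (2 : ℕ)))).pair (CodeFP.const inE (1 : ℕ)))
  have hbits : CodeFP inE strE (fun t => bitsOf 2 (R t).length) :=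
    (CodeFP.consBit.comp (hb0.pair (CodeFP.consBit.comp (hb1.pair (CodeFP.const inE ([] : List Bool)))))).congr
      fun t => (bitsOf_two _).symm
  have hbody : CodeFP inE strE (fun t => bitsOf 2 (R t).length ++ (R t).flatten) :=
    CodeFP.strAppend.comp (hbits.pair (CodeFP.strFlatten.comp hR'))
  have hAns : CodeFP inE strE
      (fun t => fit (ansLen (nameLen t.1 t.2.1)) (bitsOf 2 (R t).length ++ (R t).flatten)) :=
    FPData.fitFP.comp (hAnsLen.pair hbody)
  -- the output position `bitsToNat (fit N (y ⇂ N))`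
  have hIdx : CodeFP inE natE
      (fun t => bitsToNat (fit (nameLen t.1 t.2.1) (t.2.2.2.2.2.2.drop (nameLen t.1 t.2.1)))) :=
    CodeFP.strVal.comp (FPData.fitFP.comp (hN.pair (CodeFP.strDrop.comp (hN.pair hy))))
  have hg : CodeFP inE bitE
      (fun t => (fit (ansLen (nameLen t.1 t.2.1)) (bitsOf 2 (R t).length ++ (R t).flatten)).getD
        (bitsToNat (fit (nameLen t.1 t.2.1) (t.2.2.2.2.2.2.drop (nameLen t.1 t.2.1)))) false) :=
    CodeFP.strGetDNat.comp (hAns.pair hIdx)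
  -- the guard `1 ≤ d`
  have hcond : CodeFP inE bitE (fun t => decide (1 ≤ t.2.1)) :=
    (CodeFP.unLeNat.comp ((CodeFP.const inE (1 : ℕ)).pair (CodeFP.natOfUn.comp hd))).congr fun _ => rfl
  exact (hcond.ite hg (CodeFP.const inE false)).congr fun t => by
    by_cases h : 1 ≤ t.2.1 <;> simp [h]

/-! ## The registered stub -/

/-- **TOOLKIT G6 — assembly of `NbrBitFP P`** from the oracle stub G5: the answer string
`fit (3N+2) (bitsOf 2 |L| ++ flatten L)` and its bit at position `nameVal` of the second half of the query.
[folklore] -/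
theorem toolkit_nbrBitFP :
    ∀ (P : PuncturablePRFScheme),
      Literature.Computability.Complexity.CodeFP
        (pairE unE (pairE unE (pairE strE (pairE strE (pairE strE (pairE strE strE))))))
        (rawE strE)
        (fun t : ℕ × ℕ × List Bool × List Bool × List Bool × List Bool × List Bool =>
          if 1 ≤ t.2.1 then
            (gluedTreesOracle (cycleOf P t.1 t.2.2.2.2.1 t.2.2.2.2.2.1 t.2.1) (naming P t.1 t.2.2.1 t.2.2.2.1 t.2.1)
              (vecOf (nameLen t.1 t.2.1) t.2.2.2.2.2.2)).map List.ofFn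
          else []) →
      Literature.Computability.Complexity.CodeFP
        (pairE unE (pairE unE (pairE strE (pairE strE (pairE strE (pairE strE strE))))))
        bitE
        (fun t : ℕ × ℕ × List Bool × List Bool × List Bool × List Bool × List Bool =>
          if 1 ≤ t.2.1 then
            nbrBit (cycleOf P t.1 t.2.2.2.2.1 t.2.2.2.2.2.1 t.2.1) (naming P t.1 t.2.2.1 t.2.2.2.1 t.2.1)
              (fun i => t.2.2.2.2.2.2.getD (i : ℕ) false)
          else false) := by
  intro P hR
  refine (nbrBit_assemble _ hR).congr fun t => ?_
  by_cases h : 1 ≤ t.2.1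
  · simp only [if_pos h, nbrBit, answerBits, List.length_map, bitsToNat_fit_drop, Fin.val_castAdd,
      Fin.val_natAdd]
    rfl
  · rw [if_neg h, if_neg h]

end Summit.QuantumAdvantage.QuantumAdvantage.Theorems.WbwObfuscatedGluedTrees.KnowledgeOfWalk.Generator

end
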